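import Summits.Langlands.Langlands.Theorems.IrreducibilityBySelfDualityReciprocityUpToIrreducibilityRStringBasics
import HarnessLib

/-!
# Strings in Frobenius-semisimple Weil–Deligne representations (structure theory, part 2: summands)

Helper file for stub S-17a-B `stub_isEquivalent_of_finrank_invariants_tprod_eq` of line `Sketch`
(crux stmt-Langlands-17925 `IrreducibilityBySelfDuality.ReciprocityUpToIrreducibilityR`): Henniart
2002 Thm 1.7 (a) on the Galois side reconstructs a Frobenius-semisimple Weil–Deligne representation
from `Hom`-dimensions against indecomposables; the Galois-side input is Deligne's structure theorem
(Deligne, *Formes modulaires et représentations de GL(2)*, Antwerp II, LNM 349 (1973), Prop. 3.1.3;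
Tate, Corvallis 1979, (4.1.5)): a Frobenius-semisimple `(ρ, N)` is a direct sum of STRINGS
`H ⊕ N H ⊕ ⋯ ⊕ N^{d-1} H` ("`ρ_H ⊗ Sp(d)`") with `H` an irreducible `W_F`-stable subspace.

This file (vocabulary in `…RStringDefs`, basics in `…RStringBasics`): the KEY LEMMA — the strings through
a `W_F`-complement of `ker N^{d-1}` (`d` the nilpotency index) have a Weil–Deligne-stable complement
(induction on `d`, extending `N P` to a `W_F`-complement inside `ker N^d`) — and the registered sub-goal
`stub_exists_isStringHead_summand`: every non-zero sub-Weil–Deligne representation of a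
Frobenius-semisimple `(ρ, N)` is `string(H, d) ⊕ C` with `H` irreducible.  Pure linear algebra; no
definitions; standard axioms only.
-/

noncomputable section

set_option linter.dupNamespace false

open Module
open Literature.NumberTheory.Automorphic Literature.NumberTheory.GaloisRepresentations
open Literature.NumberTheory.GaloisRepresentations.WeilGroup
open Literature.NumberTheory.GaloisRepresentations.IsNonarchimedeanLocalField

namespace Summit.Langlands.Langlands.Theorems.ReciprocityUpToIrreducibilityR

variable {F : Type} [Field F] [ValuativeRel F] [TopologicalSpace F] [IsNonarchimedeanLocalField F]
variable {V : Type*} [AddCommGroup V] [Module ℂ V]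

/-! ## The key lemma: strings through a complement of `ker N^{d-1}` split off -/

/-- **Key lemma (Deligne's decomposition, inductive step isolated).**  Let `r` be Frobenius-semisimple,
`U` a sub-Weil–Deligne representation killed by `N^d`, and `P ≤ U` a `W_F`-stable complement of
`U ⊓ ker N^{d-1}` in `U`.  Then the string `P + N P + ⋯ + N^{d-1} P` has a Weil–Deligne-stable
complement in `U`.  Induction on `d`: inside `U₁ = U ⊓ ker N^d… = U ⊓ ker N^{d}` (for `d+1`) extend
`N P` to a `W_F`-stable complement `N P ⊕ Q` of `ker N^{d-1}` (Frobenius-semisimplicity), apply the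
induction hypothesis, and add the string of `Q` to the complement.
[cite: Deligne1973Constantes, 8.5–8.6] [cite: TateCorvallis1979, (4.1.5)] -/
theorem exists_isSubrep_compl_stringSpan [FiniteDimensional ℂ V] {r : WeilDeligneRep F ℂ V}
    (hr : r.IsFrobSemisimple) : ∀ (d : ℕ) (U P : Submodule ℂ V), r.IsSubrep U →
    U ≤ LinearMap.ker (r.N ^ d) → IsWStable r P → P ≤ U →
    P ⊔ (U ⊓ LinearMap.ker (r.N ^ (d - 1))) = U → Disjoint P (LinearMap.ker (r.N ^ (d - 1))) →
    ∃ C : Submodule ℂ V, r.IsSubrep C ∧ C ≤ U ∧ stringSpan r P d ⊔ C = U ∧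
      Disjoint (stringSpan r P d) C := by
  intro d
  induction d with
  | zero =>
    intro U P _ hUker _ hPU _ _
    rw [ker_pow_N_zero, le_bot_iff] at hUker
    refine ⟨⊥, isSubrep_bot r, bot_le, ?_, disjoint_bot_right⟩
    rw [stringSpan_zero, bot_sup_eq, hUker]
  | succ d ih =>
    intro U P hU hUker hP hPU hsup hdisj
    rw [Nat.add_sub_cancel] at hsup hdisj
    -- the next layer
    set K := LinearMap.ker (r.N ^ (d - 1)) with hK
    set U₁ := U ⊓ LinearMap.ker (r.N ^ d) with hU₁
    have hU₁sub : r.IsSubrep U₁ := isSubrep_inf hU (isSubrep_ker_pow_N r d)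
    have hU₁ker : U₁ ≤ LinearMap.ker (r.N ^ d) := inf_le_right
    set NP := P.map r.N with hNP
    have hNPU₁ : NP ≤ U₁ := by
      rintro _ ⟨p, hp, rfl⟩
      refine ⟨hU.2 (hPU hp), ?_⟩
      have := hUker (hPU hp)
      rw [LinearMap.mem_ker, pow_succ, Module.End.mul_apply] at this
      exact this
    have hNPst : IsWStable r NP := hP.map_N
    have hNPdisj : Disjoint NP K := disjoint_map_N_ker hdisj
    -- extend `N P` to a complement `N P ⊕ Q` of `U₁ ⊓ K` in `U₁`
    set A := (U₁ ⊓ K) ⊔ NP with hA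
    have hAst : IsWStable r A := (IsWStable.inf hU₁sub.1 (IsWStable.ker_pow_N r _)).sup hNPst
    have hAU₁ : A ≤ U₁ := sup_le inf_le_left hNPU₁
    obtain ⟨Q, hQst, hAQ, hAQdisj⟩ := exists_isWStable_compl hr hAst hU₁sub.1 hAU₁
    have hQU₁ : Q ≤ U₁ := hAQ ▸ le_sup_right
    set P₁ := NP ⊔ Q with hP₁
    have hP₁st : IsWStable r P₁ := hNPst.sup hQst
    have hP₁U₁ : P₁ ≤ U₁ := sup_le hNPU₁ hQU₁
    have hP₁sup : P₁ ⊔ (U₁ ⊓ K) = U₁ := by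
      calc P₁ ⊔ (U₁ ⊓ K) = ((U₁ ⊓ K) ⊔ NP) ⊔ Q := by simp only [hP₁]; ac_rfl
        _ = U₁ := hAQ
    have hP₁disj : Disjoint P₁ K := by
      rw [Submodule.disjoint_def]
      intro x hx hxK
      obtain ⟨n, hn, q, hq, rfl⟩ := Submodule.mem_sup.mp hx
      have hxA : n + q ∈ A := Submodule.mem_sup_left ⟨hP₁U₁ hx, hxK⟩
      have hqA : q ∈ A := by
        have := Submodule.sub_mem _ hxA (Submodule.mem_sup_right hn : n ∈ A)
        rwa [add_sub_cancel_left] at this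
      have hq0 : q = 0 := (Submodule.disjoint_def.mp hAQdisj) q hqA hq
      rw [hq0, add_zero] at hxK ⊢
      exact (Submodule.disjoint_def.mp hNPdisj) n hn hxK
    -- induction hypothesis inside `U₁`
    obtain ⟨C₁, hC₁sub, hC₁U₁, hS₁C₁, hS₁C₁disj⟩ :=
      ih U₁ P₁ hU₁sub hU₁ker hP₁st hP₁U₁ hP₁sup hP₁disj
    have hS₁U₁ : stringSpan r P₁ d ≤ U₁ := hS₁C₁ ▸ le_sup_left
    have hSQsub : r.IsSubrep (stringSpan r Q d) := isSubrep_stringSpan hQst (hQU₁.trans hU₁ker)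
    have hSQS₁ : stringSpan r Q d ≤ stringSpan r P₁ d := stringSpan_mono r le_sup_right d
    have hSNPS₁ : stringSpan r NP d ≤ stringSpan r P₁ d := stringSpan_mono r le_sup_left d
    refine ⟨stringSpan r Q d ⊔ C₁, isSubrep_sup hSQsub hC₁sub,
      sup_le (hSQS₁.trans (hS₁U₁.trans inf_le_left)) (hC₁U₁.trans inf_le_left), ?_, ?_⟩
    · -- `string(P, d+1) + (string(Q, d) + C₁) = P + (string(P₁, d) + C₁) = P + U₁ = U`
      rw [stringSpan_succ, sup_assoc, ← sup_assoc (stringSpan r NP d), ← stringSpan_sup, ← hP₁,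
        hS₁C₁, hsup]
    · rw [Submodule.disjoint_def]
      intro x hx hx'
      rw [stringSpan_succ] at hx
      obtain ⟨p, hp, a, ha, rfl⟩ := Submodule.mem_sup.mp hx
      have hx'U₁ : p + a ∈ U₁ := (sup_le (hSQS₁.trans hS₁U₁) hC₁U₁) hx'
      have hpU₁ : p ∈ U₁ := by
        have := Submodule.sub_mem _ hx'U₁ (hSNPS₁.trans hS₁U₁ ha)
        rwa [add_sub_cancel_right] at this
      have hp0 : p = 0 := (Submodule.disjoint_def.mp hdisj) p hp hpU₁.2
      rw [hp0, zero_add] at hx' ⊢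
      obtain ⟨b, hb, c, hc, hbc⟩ := Submodule.mem_sup.mp hx'
      have hcS₁ : c ∈ stringSpan r P₁ d := by
        have := Submodule.sub_mem _ (hSNPS₁ ha) (hSQS₁ hb)
        rwa [← hbc, add_sub_cancel_left] at this
      have hc0 : c = 0 := (Submodule.disjoint_def.mp hS₁C₁disj) c hcS₁ hc
      rw [hc0, add_zero] at hbc
      subst hbc
      -- `b ∈ string(N P, d) ⊓ string(Q, d) = 0`
      have hNPQ : Disjoint NP Q :=
        hAQdisj.mono_left (le_sup_right : NP ≤ A)
      exact (Submodule.disjoint_def.mp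
        (disjoint_stringSpan_of_disjoint (hP₁U₁.trans hU₁ker) hP₁disj le_sup_left le_sup_right hNPQ))
        b ha hb

/-! ## Every non-zero sub-Weil–Deligne representation has a string summand -/

/-- **String summands exist** (Deligne's decomposition, one step): in a Frobenius-semisimple `r`, every
non-zero sub-Weil–Deligne representation `U` splits as `U = string(H, d) ⊕ C` with `H` the
`W_F`-irreducible head of a string of length `d` (the nilpotency index of `N` on `U`) and `C` a
sub-Weil–Deligne representation.  Iterating gives `U = ⊕ strings` (Deligne 1973, Prop. 3.1.3 (ii);
Tate, Corvallis 1979, (4.1.5): `V = ⊕ ρ_i ⊗ Sp(d_i)`).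
[cite: Deligne1973Constantes, 8.5–8.6] [cite: TateCorvallis1979, (4.1.5)] -/
theorem exists_isStringHead_summand [FiniteDimensional ℂ V] {r : WeilDeligneRep F ℂ V}
    (hr : r.IsFrobSemisimple) {U : Submodule ℂ V} (hU : r.IsSubrep U) (hU0 : U ≠ ⊥) :
    ∃ (H : Submodule ℂ V) (d : ℕ) (C : Submodule ℂ V), IsStringHead r H d ∧
      stringSpan r H d ≤ U ∧ r.IsSubrep C ∧ C ≤ U ∧ stringSpan r H d ⊔ C = U ∧
      Disjoint (stringSpan r H d) C := by
  classical
  -- the nilpotency index `d` of `N` on `U`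
  have hex : ∃ k : ℕ, U ≤ LinearMap.ker (r.N ^ k) := by
    obtain ⟨k, hk⟩ := r.isNilpotent_N
    exact ⟨k, fun v _ => by rw [LinearMap.mem_ker, hk, LinearMap.zero_apply]⟩
  set d := Nat.find hex with hd
  have hUd : U ≤ LinearMap.ker (r.N ^ d) := Nat.find_spec hex
  have hdpos : 0 < d := by
    rw [Nat.pos_iff_ne_zero]
    intro h0
    rw [h0, ker_pow_N_zero, le_bot_iff] at hUd
    exact hU0 hUd
  set K := LinearMap.ker (r.N ^ (d - 1)) with hK
  have hUK : ¬ U ≤ K := Nat.find_min hex (Nat.sub_one_lt_of_lt hdpos)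
  -- `P`: a `W_F`-complement of `U ⊓ ker N^{d-1}` in `U`
  obtain ⟨P, hPst, hPsup, hPdisj⟩ :=
    exists_isWStable_compl hr (IsWStable.inf hU.1 (IsWStable.ker_pow_N r (d - 1))) hU.1 inf_le_left
  have hPU : P ≤ U := hPsup ▸ le_sup_right
  have hPK : Disjoint P K := by
    rw [Submodule.disjoint_def]
    intro x hxP hxK
    exact (Submodule.disjoint_def.mp hPdisj) x ⟨hPU hxP, hxK⟩ hxP
  have hP0 : P ≠ ⊥ := by
    intro h0
    rw [h0, sup_bot_eq] at hPsup
    exact hUK (hPsup ▸ inf_le_right)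
  -- an irreducible head `H ≤ P` and a `W_F`-complement `H₂` of `H` in `P`
  obtain ⟨H, hHP, hHirr⟩ := exists_isWIrreducible_le r hPst hP0
  obtain ⟨H₂, hH₂st, hHH₂, hHH₂disj⟩ := exists_isWStable_compl hr hHirr.2.1 hPst hHP
  have hH₂P : H₂ ≤ P := hHH₂ ▸ le_sup_right
  -- the key lemma for `P`
  obtain ⟨C₀, hC₀sub, hC₀U, hSC₀, hSC₀disj⟩ := exists_isSubrep_compl_stringSpan hr d U P hU hUd hPst
    hPU (by rw [sup_comm]; exact hPsup) hPK
  have hSP : stringSpan r P d = stringSpan r H d ⊔ stringSpan r H₂ d := by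
    rw [← stringSpan_sup, hHH₂]
  have hSH₂sub : r.IsSubrep (stringSpan r H₂ d) := isSubrep_stringSpan hH₂st (hH₂P.trans (hPU.trans hUd))
  have hSPU : stringSpan r P d ≤ U := hSC₀ ▸ le_sup_left
  refine ⟨H, d, stringSpan r H₂ d ⊔ C₀, ⟨hHirr, hdpos, hHP.trans (hPU.trans hUd), hPK.mono_left hHP⟩,
    (stringSpan_mono r hHP d).trans hSPU,
    isSubrep_sup hSH₂sub hC₀sub, sup_le ((stringSpan_mono r hH₂P d).trans hSPU) hC₀U, ?_, ?_⟩
  · rw [← sup_assoc, ← hSP, hSC₀]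
  · rw [Submodule.disjoint_def]
    intro x hx hx'
    obtain ⟨b, hb, c, hc, hbc⟩ := Submodule.mem_sup.mp hx'
    have hcS : c ∈ stringSpan r P d := by
      have := Submodule.sub_mem _ (stringSpan_mono r hHP d hx) (stringSpan_mono r hH₂P d hb)
      rwa [← hbc, add_sub_cancel_left] at this
    have hc0 : c = 0 := (Submodule.disjoint_def.mp hSC₀disj) c hcS hc
    rw [hc0, add_zero] at hbc
    subst hbc
    exact (Submodule.disjoint_def.mp
      (disjoint_stringSpan_of_disjoint (hPU.trans hUd) hPK hHP hH₂P hHH₂disj)) b hx hb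

/-- **Registered sub-goal `stub_exists_isStringHead_summand` (Deligne's decomposition, one step)**:
in a Frobenius-semisimple `r`, every non-zero sub-Weil–Deligne representation `U` is `string(H, d) ⊕ C`
with `H` the `W_F`-irreducible head of a string of length `d` and `C` a sub-Weil–Deligne representation.
[cite: TateCorvallis1979, (4.1.5)] -/
theorem stub_exists_isStringHead_summand : ∀ (F : Type) [Field F] [ValuativeRel F] [TopologicalSpace F] [IsNonarchimedeanLocalField F] (V : Type) [AddCommGroup V] [Module ℂ V] [FiniteDimensional ℂ V] (r : WeilDeligneRep F ℂ V), r.IsFrobSemisimple → ∀ (U : Submodule ℂ V), r.IsSubrep U → U ≠ ⊥ → ∃ (H : Submodule ℂ V) (d : ℕ) (C : Submodule ℂ V), IsStringHead r H d ∧ stringSpan r H d ≤ U ∧ r.IsSubrep C ∧ C ≤ U ∧ stringSpan r H d ⊔ C = U ∧ Disjoint (stringSpan r H d) C :=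
  fun _ _ _ _ _ _ _ _ _ _ hr _ hU hU0 => exists_isStringHead_summand hr hU hU0

end Summit.Langlands.Langlands.Theorems.ReciprocityUpToIrreducibilityR

end
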